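import Summits.ABC.ABC.Theses.IneffectiveSubspace

/-!
# Stub `stub_signatureBound` of line `Sketch` — crux `IneffectiveSubspace.DepthCountedABC` (stmt-ABC-14938)

CARD `signature-routing`, first lemmas: the SIGNATURE BASES (`SignatureBound`) and the AUTOMATIC
CELL (`AutomaticCell`).

* `SignatureBound` (first conjunct).  For `n` and a level `r` the squarefree signature base
  `x_r(n) := ∏_{p : v_p(n) ≥ r} p` satisfies `x_r(n)^r ∣ n`; for an abc triple `(a, b, c)` the
  three bases `x_r(a), x_s(b), x_t(c)` have pairwise disjoint prime supports (the triple is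
  pairwise coprime), so `x_r(a) · x_s(b) · x_t(c) ∣ rad(abc) = ∏_{p ∣ abc} p`.
* `AutomaticCell` (second conjunct).  If the two summands are power-poor at level `ε`, i.e.
  `a ≤ rad(a)^(1+ε)` and `b ≤ rad(b)^(1+ε)`, then `c = a + b ≤ 2 · rad(abc)^(1+ε)`, because
  `rad(a), rad(b) ≤ rad(abc)`.

Proofs.  `x_r(n)^r = ∏_{v_p(n) ≥ r} p^r ∣ ∏_{v_p(n) ≥ r} p^{v_p(n)} ∣ ∏_{p ∣ n} p^{v_p(n)} = n`
(`Finset.prod_pow`, `Finset.prod_dvd_prod_of_dvd`, `Finset.prod_dvd_prod_of_subset`,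
`Nat.prod_primeFactors_pow_factorization`).  The three filtered prime supports are sub-finsets
of `primeFactors a`, `primeFactors b`, `primeFactors c`, pairwise disjoint by
`Nat.Coprime.disjoint_primeFactors` (`gcd(a,b) = gcd(a,c) = gcd(b,c) = 1` from `a + b = c`,
`Nat.coprime_self_add_right`, `Nat.coprime_add_self_right`), so the product of the three bases is
the product over their disjoint union (`Finset.prod_union`), a sub-finset of `primeFactors (abc)`
(`Nat.primeFactors_mono`), hence divides `∏_{p ∣ abc} p = rad(abc)`
(`Finset.prod_dvd_prod_of_subset`, `Nat.radical_eq_prod_primeFactors`, `rad_def`).  The automatic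
cell: `rad a ∣ rad(abc)` (`UniqueFactorizationMonoid.radical_dvd_radical`), so `rad a ≤ rad(abc)`
(`Nat.le_of_dvd`, `Nat.radical_pos`) and `rad(a)^(1+ε) ≤ rad(abc)^(1+ε)` (`Real.rpow_le_rpow`,
exponent `1 + ε ≥ 0`); the same for `b`; add the two bounds.

Sources: skeleton `Cruxes/DepthCountedABC/Lines/Sketch.lean` of lead `prover-line-stmt-ABC-14938-0`
(wave 2, stub `stub_signatureBound`).  Mathlib only.
Deliberately NOT here: the routing of signatures into cells, the power-rich residual and the
other stubs of the line.
-/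

-- `Summit.<Summit>.<Problem>` is the mandated summit-side namespace (CONVENTIONS §2); for the
-- single-conjunct summit `ABC` the two coincide, so the duplicate `ABC.ABC` is deliberate.
set_option linter.dupNamespace false

namespace Summit.ABC.ABC.Theorems.DepthCountedABC

open scoped BigOperators

/-- The squarefree signature base `x_r(n) = ∏_{p : v_p(n) ≥ r} p` of `n` at level `r` satisfies
`x_r(n)^r ∣ n`: indeed `x_r(n)^r = ∏ p^r ∣ ∏ p^{v_p(n)} ∣ n`. [folklore] -/
theorem signatureBound_base_pow_dvd (n r : ℕ) :
    (∏ p ∈ n.primeFactors.filter (fun p => r ≤ n.factorization p), p) ^ r ∣ n := by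
  rcases eq_or_ne n 0 with rfl | hn
  · exact dvd_zero _
  rw [← Finset.prod_pow]
  calc ∏ p ∈ n.primeFactors.filter (fun p => r ≤ n.factorization p), p ^ r
      ∣ ∏ p ∈ n.primeFactors.filter (fun p => r ≤ n.factorization p), p ^ n.factorization p :=
        Finset.prod_dvd_prod_of_dvd _ _ fun p hp => pow_dvd_pow p (Finset.mem_filter.mp hp).2
    _ ∣ ∏ p ∈ n.primeFactors, p ^ n.factorization p :=
        Finset.prod_dvd_prod_of_subset _ _ _ (Finset.filter_subset _ _)
    _ = n := (Nat.prod_primeFactors_pow_factorization hn).symm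

/-- The prime support `{p : v_p(n) ≥ r}` of the signature base of `n` lies in the prime support of
any nonzero multiple `m` of `n`. [folklore] -/
theorem signatureBound_filter_subset {n m : ℕ} (r : ℕ) (h : n ∣ m) (hm : m ≠ 0) :
    n.primeFactors.filter (fun p => r ≤ n.factorization p) ⊆ m.primeFactors :=
  (Finset.filter_subset _ _).trans (Nat.primeFactors_mono h hm)

/-- For coprime `n, m` the prime supports of their signature bases (at any levels `r, s`) are
disjoint. [folklore] -/
theorem signatureBound_filter_disjoint {n m : ℕ} (r s : ℕ) (h : Nat.Coprime n m) :
    Disjoint (n.primeFactors.filter (fun p => r ≤ n.factorization p))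
      (m.primeFactors.filter (fun p => s ≤ m.factorization p)) :=
  Disjoint.mono (Finset.filter_subset _ _) (Finset.filter_subset _ _) h.disjoint_primeFactors

/-- **SignatureBound.**  For an abc triple `(a, b, c)` and levels `r, s, t` the product of the three
signature bases `x_r(a) · x_s(b) · x_t(c)` divides `rad(abc)`: the three prime supports are pairwise
disjoint sub-finsets of `primeFactors (abc)` (the triple is pairwise coprime), and
`rad(abc) = ∏_{p ∣ abc} p`. [folklore] -/
theorem signatureBound_prod_dvd_rad {a b c : ℕ}
    (habc : Literature.NumberTheory.DiophantineGeometry.IsABCTriple a b c) (r s t : ℕ) :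
    (∏ p ∈ a.primeFactors.filter (fun p => r ≤ a.factorization p), p) *
        (∏ p ∈ b.primeFactors.filter (fun p => s ≤ b.factorization p), p) *
        (∏ p ∈ c.primeFactors.filter (fun p => t ≤ c.factorization p), p) ∣
      Literature.NumberTheory.DiophantineGeometry.rad a b c := by
  obtain ⟨ha, hb, hsum, hcop⟩ := habc
  have hc : 0 < c := by omega
  have hne : a * b * c ≠ 0 := by positivity
  -- the two other coprimalities of the triple
  have hac : Nat.Coprime a c := by
    rw [← hsum]; exact Nat.coprime_self_add_right.mpr hcop
  have hbc : Nat.Coprime b c := by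
    rw [← hsum]; exact Nat.coprime_add_self_right.mpr hcop.symm
  have hdab := signatureBound_filter_disjoint r s hcop
  have hdac := signatureBound_filter_disjoint r t hac
  have hdbc := signatureBound_filter_disjoint s t hbc
  rw [← Finset.prod_union hdab,
    ← Finset.prod_union (Finset.disjoint_union_left.mpr ⟨hdac, hdbc⟩),
    Literature.NumberTheory.DiophantineGeometry.rad_def, Nat.radical_eq_prod_primeFactors]
  refine Finset.prod_dvd_prod_of_subset _ _ _
    (Finset.union_subset (Finset.union_subset ?_ ?_) ?_)
  · exact signatureBound_filter_subset r (dvd_mul_of_dvd_left (dvd_mul_right a b) c) hne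
  · exact signatureBound_filter_subset s (dvd_mul_of_dvd_left (dvd_mul_left b a) c) hne
  · exact signatureBound_filter_subset t (dvd_mul_left c (a * b)) hne

/-- `rad n ≤ rad m` (cast to `ℝ`) for a divisor `n` of a nonzero `m`. [folklore] -/
theorem signatureBound_radical_cast_le {n m : ℕ} (h : n ∣ m) (hm : m ≠ 0) :
    ((UniqueFactorizationMonoid.radical n : ℕ) : ℝ) ≤
      ((UniqueFactorizationMonoid.radical m : ℕ) : ℝ) := by
  exact_mod_cast
    Nat.le_of_dvd (Nat.radical_pos m) (UniqueFactorizationMonoid.radical_dvd_radical h hm)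

/-- **AutomaticCell.**  If both summands of an abc triple are power-poor at level `ε > 0`, i.e.
`a ≤ rad(a)^(1+ε)` and `b ≤ rad(b)^(1+ε)`, then `c ≤ 2 · rad(abc)^(1+ε)`
(`c = a + b` and `rad a, rad b ≤ rad(abc)`). [folklore] -/
theorem signatureBound_automaticCell (ε : ℝ) (hε : 0 < ε) {a b c : ℕ}
    (habc : Literature.NumberTheory.DiophantineGeometry.IsABCTriple a b c)
    (hA : (a : ℝ) ≤ ((UniqueFactorizationMonoid.radical a : ℕ) : ℝ) ^ (1 + ε))
    (hB : (b : ℝ) ≤ ((UniqueFactorizationMonoid.radical b : ℕ) : ℝ) ^ (1 + ε)) :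
    (c : ℝ) ≤ 2 * ((Literature.NumberTheory.DiophantineGeometry.rad a b c : ℕ) : ℝ) ^ (1 + ε) := by
  obtain ⟨ha, hb, hsum, hcop⟩ := habc
  have hc : 0 < c := by omega
  have hne : a * b * c ≠ 0 := by positivity
  have hε1 : (0 : ℝ) ≤ 1 + ε := by linarith
  rw [Literature.NumberTheory.DiophantineGeometry.rad_def]
  have hRa : ((UniqueFactorizationMonoid.radical a : ℕ) : ℝ) ^ (1 + ε) ≤
      ((UniqueFactorizationMonoid.radical (a * b * c) : ℕ) : ℝ) ^ (1 + ε) :=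
    Real.rpow_le_rpow (Nat.cast_nonneg _)
      (signatureBound_radical_cast_le (dvd_mul_of_dvd_left (dvd_mul_right a b) c) hne) hε1
  have hRb : ((UniqueFactorizationMonoid.radical b : ℕ) : ℝ) ^ (1 + ε) ≤
      ((UniqueFactorizationMonoid.radical (a * b * c) : ℕ) : ℝ) ^ (1 + ε) :=
    Real.rpow_le_rpow (Nat.cast_nonneg _)
      (signatureBound_radical_cast_le (dvd_mul_of_dvd_left (dvd_mul_left b a) c) hne) hε1
  have hcsum : (c : ℝ) = (a : ℝ) + (b : ℝ) := by
    rw [← hsum, Nat.cast_add]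
  rw [hcsum]
  linarith

/-- **Stub `stub_signatureBound` of line `Sketch`, crux `DepthCountedABC` (stmt-ABC-14938)** — card
`signature-routing`, `SignatureBound ∧ AutomaticCell`, fully unfolded.
(1) For an abc triple `(a, b, c)` and levels `r, s, t ≥ 1`, the squarefree signature bases
`x_r(a) = ∏_{v_p(a) ≥ r} p`, `x_s(b)`, `x_t(c)` satisfy `x_r(a) · x_s(b) · x_t(c) ∣ rad(abc)`,
`x_r(a)^r ∣ a`, `x_s(b)^s ∣ b`, `x_t(c)^t ∣ c`.
(2) For `ε > 0`, if `a ≤ rad(a)^(1+ε)` and `b ≤ rad(b)^(1+ε)` then `c ≤ 2 · rad(abc)^(1+ε)`.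
[folklore] -/
theorem stub_signatureBound :
    (∀ a b c r s t : ℕ, Literature.NumberTheory.DiophantineGeometry.IsABCTriple a b c →
      1 ≤ r → 1 ≤ s → 1 ≤ t →
      (∏ p ∈ a.primeFactors.filter (fun p => r ≤ a.factorization p), p) *
        (∏ p ∈ b.primeFactors.filter (fun p => s ≤ b.factorization p), p) *
        (∏ p ∈ c.primeFactors.filter (fun p => t ≤ c.factorization p), p) ∣
        Literature.NumberTheory.DiophantineGeometry.rad a b c ∧
      (∏ p ∈ a.primeFactors.filter (fun p => r ≤ a.factorization p), p) ^ r ∣ a ∧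
      (∏ p ∈ b.primeFactors.filter (fun p => s ≤ b.factorization p), p) ^ s ∣ b ∧
      (∏ p ∈ c.primeFactors.filter (fun p => t ≤ c.factorization p), p) ^ t ∣ c) ∧
    (∀ ε : ℝ, 0 < ε → ∀ a b c : ℕ, Literature.NumberTheory.DiophantineGeometry.IsABCTriple a b c →
      (a : ℝ) ≤ ((UniqueFactorizationMonoid.radical a : ℕ) : ℝ) ^ (1 + ε) →
      (b : ℝ) ≤ ((UniqueFactorizationMonoid.radical b : ℕ) : ℝ) ^ (1 + ε) →
      (c : ℝ) ≤ 2 * ((Literature.NumberTheory.DiophantineGeometry.rad a b c : ℕ) : ℝ) ^ (1 + ε)) :=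
  ⟨fun a b c r s t habc _ _ _ =>
    ⟨signatureBound_prod_dvd_rad habc r s t, signatureBound_base_pow_dvd a r,
      signatureBound_base_pow_dvd b s, signatureBound_base_pow_dvd c t⟩,
    fun ε hε _ _ _ habc hA hB => signatureBound_automaticCell ε hε habc hA hB⟩

end Summit.ABC.ABC.Theorems.DepthCountedABC
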